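import Literature.AlgebraicGeometry.HodgeTheory.AtiyahClassTraceConjugation
import HarnessLib

/-!
# `{0,1}`-semiregularity is invariant under isomorphism

PROMOTED LITERATURE COPY (librarian protocol (b); DEFREQ-CoherentISemiregular, cell pub-hsemireg) of the generic, conjecture-free
`Summits/HodgeConjecture/HodgeConjecture/Theorems/PadicSemiregularLiftPadicPridhamSemiregularitySemiregularOfIso.lean` — namespace now `Literature.AlgebraicGeometry.HodgeTheory`, names kept; cell words (seats, ventures) = provenance.

For a commutative ring `k`, a `k`-scheme `Y`, finite locally free `𝒪_Y`-modules `E`, `E'` and an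
isomorphism `e : E ≅ E'`, the `{0,1}`-semiregularity of `E` (injectivity of
`(σ₀, σ₁) = (Tr, Tr_{Ω¹}(− ∘ At)) : Ext²(E, E) → H²(Y, 𝒪) × H³(Y, Ω¹_{Y/k})`, the tree's real
`HodgeTheory.IsZeroOneSemiregular`) implies that of `E'` (`isZeroOneSemiregular_of_iso`; the route-registration
form `stub_isZeroOneSemiregular_of_iso` of the original file is NOT copied).

Proof. Conjugation `c(x') = e ≫ x' ≫ e⁻¹ : Ext²(E', E') → Ext²(E, E)` is injective (its inverse is
conjugation by `e⁻¹`), so it suffices that `σᵢ^E ∘ c = σᵢ^{E'}` (`sigmaZero_conj`, `sigmaOne_conj`).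
Writing `σ₀ = H² ∘ Tr` with `Tr(x) = u_E ≫ 𝓗om(E, x) ≫ tr_E` and
`σ₁(x) = H³(u_E ≫ 𝓗om(E, x ≫ At(E)) ≫ c_{Ω¹})`, this follows from the companion file
`…TraceConjugation.lean`: (1) `𝓗om(E, –)` and `𝓗om(E', –)` act on `Ext` conjugately through the
natural isomorphism `𝓗om(e, –)` (`mapExactFunctor_sheafHomFunctor_eq`, from the naturality of
`Ext.mapExactFunctor` in the exact functor); (2) the unit, trace and contraction are conjugation
invariant (`sheafHomUnit_conj`, `trace_conj`, `contract_conj`); (3) the Atiyah class is natural,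
`e⁻¹ ≫ At(E) = At(E') ≫ (e⁻¹ ⊗ 1)` (`atiyahClass_naturality`). Hence `traceExt_conj`,
`traceExtCoeff_conj`, `isZeroOneSemiregular_of_iso`. Everything proved; no named facts.

## References

* R.-O. Buchweitz, H. Flenner, *A semiregularity map for modules and applications to deformations*,
  Compositio Math. 137 (2003), §4 (trace maps), §5 (`I`-semiregularity). [BuchweitzFlenner2003]
* M. F. Atiyah, Trans. AMS 85 (1957), §4, Prop. 6–7. [Atiyah1957]
-/

noncomputable section

open CategoryTheory CategoryTheory.Limits CategoryTheory.Abelian AlgebraicGeometry Opposite TopologicalSpace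
  Literature.AlgebraicGeometry.Motives Literature.AlgebraicGeometry.HodgeTheory Literature.AlgebraicGeometry.Modules

universe w u

namespace Literature.AlgebraicGeometry.HodgeTheory

/-! ### Conjugation invariance of `σ_0`, `σ_1` and the transport of `{0,1}`-semiregularity -/

section Sigma

variable {S : Type u} [CommRing S] {X : Over (Spec (CommRingCat.of S))} [HasExt.{w} X.left.Modules]
  {E E' : X.left.Modules} (e : E ≅ E') (hE : IsFiniteLocallyFree E) (hE' : IsFiniteLocallyFree E')

/-- `𝓗om(E, –)` on `Ext` is conjugate to `𝓗om(E', –)` on `Ext` by the isomorphism `𝓗om(e, –)`. [cite: Weibel1994, Def. 10.2.1 and §10.7 (translation functor; Ext and RHom)] -/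
lemma mapExactFunctor_sheafHomFunctor_eq {A B : X.left.Modules} {n : ℕ} (y : Ext.{w} A B n) :
    haveI := preservesFiniteColimits_sheafHomFunctor E hE
    haveI := preservesFiniteColimits_sheafHomFunctor E' hE'
    y.mapExactFunctor (sheafHomFunctor E) =
      (Ext.mk₀ (sheafHomPrecomp e.inv A)).comp ((y.mapExactFunctor (sheafHomFunctor E')).comp
        (Ext.mk₀ (sheafHomPrecomp e.hom B)) (add_zero n)) (zero_add n) := by
  haveI := preservesFiniteColimits_sheafHomFunctor E hE
  haveI := preservesFiniteColimits_sheafHomFunctor E' hE'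
  have key := Ext.mk₀_comp_mapExactFunctor_of_natIso (sheafHomFunctor E') (sheafHomFunctor E)
    (sheafHomFunctorIso e) y
  dsimp only [sheafHomFunctorIso_hom_app, sheafHomFunctor_obj] at key ⊢
  rw [← key, Ext.mk₀_comp_mk₀_assoc, sheafHomPrecomp_inv_hom_id, Ext.mk₀_id_comp]

/-- **`Tr` is conjugation-invariant on `Ext`**: `Tr_E(e ≫ x' ≫ e⁻¹) = Tr_{E'}(x')` for `e : E ≅ E'`.
[cite: BuchweitzFlenner2003, §4 (trace map, before Def. 4.1)] -/
theorem traceExt_conj (n : ℕ) (x' : Ext.{w} E' E' n) :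
    traceExt hE n ((Ext.mk₀ e.hom).comp (x'.comp (Ext.mk₀ e.inv) (add_zero n)) (zero_add n)) =
      traceExt hE' n x' := by
  haveI := preservesFiniteColimits_sheafHomFunctor E hE
  haveI := preservesFiniteColimits_sheafHomFunctor E' hE'
  rw [traceExt_apply, traceExt_apply, Ext.mapExactFunctor_comp, Ext.mapExactFunctor_comp,
    Ext.mapExactFunctor_mk₀, Ext.mapExactFunctor_mk₀, mapExactFunctor_sheafHomFunctor_eq e hE hE']
  dsimp only [sheafHomFunctor_obj]
  simp only [sheafHomFunctor_map, Ext.comp_assoc_of_second_deg_zero, Ext.comp_assoc_of_third_deg_zero,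
    Ext.mk₀_comp_mk₀, Ext.mk₀_comp_mk₀_assoc, Category.assoc, sheafHomUnit_conj, trace_conj e hE hE']

/-- **`Tr_G` is conjugation-invariant on `Ext`** (coefficients `G`, twist transported by `e⁻¹ ⊗ 1`).
[cite: BuchweitzFlenner2003, §4 (trace map, before Def. 4.1)] -/
theorem traceExtCoeff_conj (G : X.left.Modules) (n : ℕ) (y' : Ext.{w} E' (sheafHom (dual E') G) n) :
    traceExtCoeff hE G n ((Ext.mk₀ e.hom).comp (y'.comp (Ext.mk₀ (twistMap e.inv G)) (add_zero n))
      (zero_add n)) = traceExtCoeff hE' G n y' := by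
  haveI := preservesFiniteColimits_sheafHomFunctor E hE
  haveI := preservesFiniteColimits_sheafHomFunctor E' hE'
  rw [traceExtCoeff_apply, traceExtCoeff_apply, Ext.mapExactFunctor_comp, Ext.mapExactFunctor_comp,
    Ext.mapExactFunctor_mk₀, Ext.mapExactFunctor_mk₀, mapExactFunctor_sheafHomFunctor_eq e hE hE']
  dsimp only [sheafHomFunctor_obj]
  simp only [sheafHomFunctor_map, Ext.comp_assoc_of_second_deg_zero, Ext.comp_assoc_of_third_deg_zero,
    Ext.mk₀_comp_mk₀, Ext.mk₀_comp_mk₀_assoc, Category.assoc, sheafHomUnit_conj, contract_conj e hE hE']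

/-- **`σ_0` is conjugation-invariant**: `σ_0^{E}(e ≫ x' ≫ e⁻¹) = σ_0^{E'}(x')`. [cite: BuchweitzFlenner2003, Def. 4.1] -/
theorem sigmaZero_conj (x' : Ext.{w} E' E' 2) :
    sigmaZero hE ((Ext.mk₀ e.hom).comp (x'.comp (Ext.mk₀ e.inv) (add_zero 2)) (zero_add 2)) =
      sigmaZero hE' x' := by
  rw [sigmaZero_apply, sigmaZero_apply, traceExt_conj]

/-- **`σ_1` is conjugation-invariant**: `σ_1^{E}(e ≫ x' ≫ e⁻¹) = σ_1^{E'}(x')` (naturality of the Atiyah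
class along `e⁻¹`, then conjugation invariance of `Tr_{Ω¹}`). [cite: BuchweitzFlenner2003, Def. 4.1] -/
theorem sigmaOne_conj (x' : Ext.{w} E' E' 2) :
    sigmaOne hE ((Ext.mk₀ e.hom).comp (x'.comp (Ext.mk₀ e.inv) (add_zero 2)) (zero_add 2)) =
      sigmaOne hE' x' := by
  rw [sigmaOne_apply, sigmaOne_apply, traceCoeffToCohomology, traceCoeffToCohomology,
    AddMonoidHom.comp_apply, AddMonoidHom.comp_apply, ← traceExtCoeff_conj e hE hE']
  congr 1
  rw [Ext.comp_assoc _ _ _ (zero_add 2) (rfl : 2 + 1 = 3) (by omega),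
    Ext.comp_assoc _ _ _ (add_zero 2) (zero_add 1) (by omega),
    ← atiyahClass_naturality e.inv, ← Ext.comp_assoc_of_third_deg_zero]

end Sigma

section Transport

variable {S : Type u} [CommRing S] {X : Over (Spec (CommRingCat.of S))} [HasExt.{w} X.left.Modules]
  {E E' : X.left.Modules}

/-- **`{0,1}`-semiregularity is invariant under isomorphism** of finite locally free modules:
conjugation `x' ↦ e ≫ x' ≫ e⁻¹` is injective `Ext²(E', E') → Ext²(E, E)` and intertwines `(σ_0, σ_1)`.
[cite: BuchweitzFlenner2003, §5 (I-semiregular)] -/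
theorem isZeroOneSemiregular_of_iso (e : E ≅ E') (hE : IsFiniteLocallyFree E)
    (hE' : IsFiniteLocallyFree E') (h : IsZeroOneSemiregular hE) : IsZeroOneSemiregular hE' := by
  intro x' y' hxy
  have hc : (Ext.mk₀ e.hom).comp (x'.comp (Ext.mk₀ e.inv) (add_zero 2)) (zero_add 2) =
      (Ext.mk₀ e.hom).comp (y'.comp (Ext.mk₀ e.inv) (add_zero 2)) (zero_add 2) := by
    apply h
    change (sigmaZero hE _, sigmaOne hE _) = (sigmaZero hE _, sigmaOne hE _)
    rw [sigmaZero_conj, sigmaZero_conj, sigmaOne_conj, sigmaOne_conj]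
    exact hxy
  have := congrArg (fun z : Ext E E 2 => (Ext.mk₀ e.inv).comp (z.comp (Ext.mk₀ e.hom) (add_zero 2))
    (zero_add 2)) hc
  simpa only [Ext.comp_assoc_of_second_deg_zero, Ext.comp_assoc_of_third_deg_zero, Ext.mk₀_comp_mk₀,
    Ext.mk₀_comp_mk₀_assoc, Iso.inv_hom_id, Ext.mk₀_id_comp, Ext.comp_mk₀_id] using this

end Transport

end Literature.AlgebraicGeometry.HodgeTheory

end
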